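import Literature.MathematicalPhysics.QuantumFieldTheory.Balaban1983to89.B9KnitRows1517AtPinnedShapesY
import Literature.MathematicalPhysics.QuantumFieldTheory.Balaban1983to89.Node00.OpsYBondMapOfRecord

/-!
# `Balaban1983to89.B9KnitRow1516DisplayBridgeY` — T. Bałaban, *Propagators for lattice gauge theories in a background field*, Commun. Math. Phys. **99** (1985)
# 389–434 [Balaban1985BackgroundPropagators], Thm 3.2 (3.48) p. 398 ∕ (3.96) p. 411 AT THE KNIT RECORD — THE TWO TYPINGS OF ROWS 15–16's DISPLAY ARE ONE: the knit
# certificate «KC» (`Thm/…N06AtOpsYSectEStKnitPairKC`, dag-n06-d ✓ 2026-08-30) displays `h348` (`Conv348Blk (oneCubeOps39 (geo9Y x) (bg9YR …) (blk39F … (bI x))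
# (L39 x (parKnitY x) (𝔏 x).Gp)) …`) AND `h348F` (`Conv348Blk (oneCubeOps39YF θ M⋆ 𝔏 bI x) …`) at the same constants; under the certificate's letter pin
# `(𝔏 x).parS = parKnitY x` the second follows from the first pointwise (and conversely) — plus rows 15–16's theorem at the bond map of record `bIYOfRecord`

statement-level skeleton of published theorems with citation tags; proofs where landed; nothing here is a claim about the Yang–Mills mass gap

THE PRINT.  Thm 3.2 (3.48) p. 398; (3.95)–(3.96) p. 411 (the block majorant of `(Q′G′²Q′*)⁻¹` read on the inverse); (3.19) p. 393 (the knit transporters); (3.35) p. 396;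
[4] (2.45) p. 231, (2.51) p. 232, p. 248 («sites replaced by bonds»).

WHY THIS FILE (cell `pub-ymgap`, node N06, seat `dag-n06-j` gen 37 = bundle F5 rows 15–16; consumer = the «KE» fold after «KC» ✓p795195).  dag-n06-d's diagnosis (bus
2026-08-30T22:27Z): feeding «KA»'s `h348` into «KD»'s `h348F` slot makes the unifier loop (`(𝔏 x).parS` vs `parKnitY` under `oneCubeOps39YF` is not definitional), so «KC»
displays BOTH.  THIS FILE is the explicit bridge: `Conv348Blk` reads an `Ops39Blk` only through `.L U` and `.blk` (the background token `bg9Y ∕ bg9YR` rides in `.Cfg`,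
`B9Thm39FacesAtLettersRC.conv348Blk_oneCubeYFR_iff`), so after ONE rewrite of the pin the two displays coincide — §1 states it as an `Iff` and as the two implications
between «KC»'s binders VERBATIM (same `M39 a39 B39 δ39`); §2 re-keys this seat's rows-15∕16 theorem (`B9Thm32Conv348AtKnitLetterOfRegYP335`, section-carrying members)
at the certificate's bond map of record `bI := bIYOfRecord θ M⋆` (pin `hbI`), its faithfulness binder `hβI` discharged by node00-def-Y's `bIYOfRecord_hβI`.

WHAT IS PROVED (sorry-free; 0 `def`; bookkeeping only).
* §1 ★ `conv348Blk_oneCubeYF_iff_knitPin` (pointwise `Iff` under the pin), ★★ `h348F_of_h348_knitPin` ∕ `h348_of_h348F_knitPin` («KC»'s two binders, either from the other).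
* §2 `conv348_oneCube_parKnitY_bIYOfRecord_of_regYR_section` (rows 15–16 at `bIYOfRecord`, `(𝔏 x).Gp`-pinned letters, section-carrying members; no `hβI` binder).
HONEST SCOPE.  Re-typings; no estimate asserted or re-proved; inner-corner members stay outside §2; helper, count-neutral; N06 NOT discharged; nothing continuum ∕ OS ∕ mass
gap ∕ Clay — the Yang–Mills mass gap is NOT proved here.  No `sorry`, no `axiom`, no `instance`, no `notation`, no `def`.  NEW file.
RELATED, NOT DUPLICATED (searched 2026-08-30: `rg -l -w "KnitRow1516DisplayBridge|h348F_of_h348_knitPin|conv348Blk_oneCubeYF_iff_knitPin"` over `lean/{Literature,Summits,HarnessLib}`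
= ∅): `B9Thm39FacesAtLettersRC.conv348Blk_oneCubeYFR_iff` (the `bg9YR ↔ bg9Y` typing only, no pin — USED), `B9KnitRows1517AtPinnedShapesY` (the ∃-packaged YF form — a
different statement: here the constants are the CONSUMER's), `B9Thm32Conv348AtKnitLetterOfRegYP335` (§2's parent).
-/

noncomputable section

namespace Literature.MathematicalPhysics.QuantumFieldTheory.Balaban1983to89.B9KnitRow1516DisplayBridgeY

open Literature.MathematicalPhysics.QuantumFieldTheory.Balaban1983to89
open Node00 B9Thm39WholeBlk B9Thm39ReadingCoords B9Thm39ReadingAtLetters B9Thm39OneCubeReadingAtLettersY B9Thm39PureGaugeClassAtLettersR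
  B6KLevelCensusIndexV1 B6Ineq2142KLevelV1 B6GlobalChartV1 B9PinMembersKLevelV1 B9PinGeometryKLevelV1 B9GeoNormsKLevelV1
  B9BackgroundsKLevelV1 B9BackgroundsKLevelV1P B9BackgroundsKLevelV1R B7Prop2SpecialUnitary
open Literature.MathematicalPhysics.QuantumFieldTheory.Balaban1983to89.B9Ineq349SiteFromConv348 (blk39F)
open Literature.MathematicalPhysics.QuantumFieldTheory.Balaban1983to89.B9B8AveragingJunction (parKnitY)
open Literature.MathematicalPhysics.QuantumFieldTheory.Balaban1983to89.Node00.OpsYBondMapOfRecord (bIYOfRecord bIYOfRecord_hβI)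
open Literature.MathematicalPhysics.QuantumFieldTheory.Balaban1983to89.B9Thm32Conv348AtKnitLetterOfRegYP335 (conv348_oneCube_parKnitY_of_regYR_section_letters)
open scoped Matrix.Norms.L2Operator

variable {N : ℕ} (θ : Stage3Params) (Mstar : ℕ) (𝔏 : LettersY N θ Mstar)
variable [∀ x : MemberY θ.d₆ θ.ℓ₆ θ.hd' θ.hL' θ.b₀ θ.b₁ Mstar, Fintype (geo9Y x).Site]

/-! ## §1 The two typings of the display are one under the letter pin `(𝔏 x).parS = parKnitY x` -/

/-- ★ **ONE DISPLAY, TWO TYPINGS**: under the pin `(𝔏 x).parS = parKnitY x`, «KD»'s `Conv348Blk (oneCubeOps39YF θ M⋆ 𝔏 bI x) B δ U` IS «KA»'s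
`Conv348Blk (oneCubeOps39 (geo9Y x) (bg9YR … R₁ R₂ x) (blk39F … (bI x)) (L39 x.toKIdx (parKnitY x.toKIdx) (𝔏 x).Gp)) B δ U` (same operator letter after the rewrite, same block map;
the background token rides in `.Cfg` only). [cite: Balaban1985BackgroundPropagators, Thm 3.2 (3.48) p.398 + (3.96) p.411 + (3.19) p.393; Balaban1984PropagatorsII, (2.51) p.232 (bookkeeping: the two typings)] -/
theorem conv348Blk_oneCubeYF_iff_knitPin {x : MemberY θ.d₆ θ.ℓ₆ θ.hd' θ.hL' θ.b₀ θ.b₁ Mstar} (hP : (𝔏 x).parS = parKnitY x.toKIdx)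
    (R₁ R₂ : RegFamY θ.d₆ θ.ℓ₆ θ.hd' θ.hL' θ.b₀ θ.b₁ Mstar (Matrix (Fin N) (Fin N) ℂ))
    (bI : ∀ x : MemberY θ.d₆ θ.ℓ₆ θ.hd' θ.hL' θ.b₀ θ.b₁ Mstar, FBondY x.toKIdx → IBondY x.toKIdx) (B δ : ℝ) (U : CfgY (Matrix (Fin N) (Fin N) ℂ) x.toKIdx) :
    Conv348Blk (oneCubeOps39YF θ Mstar 𝔏 bI x) B δ U ↔
      Conv348Blk (oneCubeOps39 (geo9Y x) (bg9YR (Matrix (Fin N) (Fin N) ℂ) (specialUnitaryUnits (Fin N)) R₁ R₂ x)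
        (blk39F (Matrix (Fin N) (Fin N) ℂ) x.toKIdx (bI x)) (L39 x.toKIdx (parKnitY x.toKIdx) (𝔏 x).Gp)) B δ U := by
  rw [← B9Thm39FacesAtLettersRC.conv348Blk_oneCubeYFR_iff θ Mstar 𝔏 R₁ R₂ bI x B δ U]
  show Conv348Blk (oneCubeOps39 (geo9Y x) (bg9YR (Matrix (Fin N) (Fin N) ℂ) (specialUnitaryUnits (Fin N)) R₁ R₂ x)
      (blk39F (Matrix (Fin N) (Fin N) ℂ) x.toKIdx (bI x)) (L39 x.toKIdx (𝔏 x).parS (𝔏 x).Gp)) B δ U ↔ _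
  rw [hP]

/-- ★★ **«KC»'s `h348F` FROM ITS `h348`** (both binders VERBATIM, same `M39 a39 B39 δ39`), under the letter pin `∀ x, (𝔏 x).parS = parKnitY x`: the «KE» fold may drop the
second display. [cite: Balaban1985BackgroundPropagators, Thm 3.2 (3.48) p.398 + (3.96) p.411 + (3.19) p.393 (bookkeeping)] -/
theorem h348F_of_h348_knitPin (hP : ∀ x : MemberY θ.d₆ θ.ℓ₆ θ.hd' θ.hL' θ.b₀ θ.b₁ Mstar, (𝔏 x).parS = parKnitY x.toKIdx)
    {R₁ R₂ : RegFamY θ.d₆ θ.ℓ₆ θ.hd' θ.hL' θ.b₀ θ.b₁ Mstar (Matrix (Fin N) (Fin N) ℂ)} {c M39 a39 B39 δ39 : ℝ}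
    {bI : ∀ x : MemberY θ.d₆ θ.ℓ₆ θ.hd' θ.hL' θ.b₀ θ.b₁ Mstar, FBondY x.toKIdx → IBondY x.toKIdx}
    (h348 : ∀ x : MemberY θ.d₆ θ.ℓ₆ θ.hd' θ.hL' θ.b₀ θ.b₁ Mstar, M39 ≤ (geo9Y x).M → ∀ α₀ : ℝ, 0 < α₀ → c * (geo9Y x).M * α₀ ≤ a39 →
      ∀ U : (bg9YR (Matrix (Fin N) (Fin N) ℂ) (specialUnitaryUnits (Fin N)) R₁ R₂ x).Cfg,
        (bg9YR (Matrix (Fin N) (Fin N) ℂ) (specialUnitaryUnits (Fin N)) R₁ R₂ x).Reg335 c α₀ U →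
          Conv348Blk (oneCubeOps39 (geo9Y x) (bg9YR (Matrix (Fin N) (Fin N) ℂ) (specialUnitaryUnits (Fin N)) R₁ R₂ x)
            (blk39F (Matrix (Fin N) (Fin N) ℂ) x.toKIdx (bI x)) (L39 x.toKIdx (parKnitY x.toKIdx) (𝔏 x).Gp)) B39 δ39 U) :
    ∀ x : MemberY θ.d₆ θ.ℓ₆ θ.hd' θ.hL' θ.b₀ θ.b₁ Mstar, M39 ≤ (geo9Y x).M → ∀ α₀ : ℝ, 0 < α₀ → c * (geo9Y x).M * α₀ ≤ a39 →
      ∀ U : (bg9YR (Matrix (Fin N) (Fin N) ℂ) (specialUnitaryUnits (Fin N)) R₁ R₂ x).Cfg,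
        (bg9YR (Matrix (Fin N) (Fin N) ℂ) (specialUnitaryUnits (Fin N)) R₁ R₂ x).Reg335 c α₀ U →
          Conv348Blk (oneCubeOps39YF θ Mstar 𝔏 bI x) B39 δ39 U :=
  fun x hM α₀ hα ha U hU => (conv348Blk_oneCubeYF_iff_knitPin θ Mstar 𝔏 (hP x) R₁ R₂ bI B39 δ39 U).2 (h348 x hM α₀ hα ha U hU)

/-- ★ **THE CONVERSE: «KC»'s `h348` FROM ITS `h348F`** under the same pin. [cite: Balaban1985BackgroundPropagators, Thm 3.2 (3.48) p.398 + (3.96) p.411 + (3.19) p.393 (bookkeeping)] -/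
theorem h348_of_h348F_knitPin (hP : ∀ x : MemberY θ.d₆ θ.ℓ₆ θ.hd' θ.hL' θ.b₀ θ.b₁ Mstar, (𝔏 x).parS = parKnitY x.toKIdx)
    {R₁ R₂ : RegFamY θ.d₆ θ.ℓ₆ θ.hd' θ.hL' θ.b₀ θ.b₁ Mstar (Matrix (Fin N) (Fin N) ℂ)} {c M39 a39 B39 δ39 : ℝ}
    {bI : ∀ x : MemberY θ.d₆ θ.ℓ₆ θ.hd' θ.hL' θ.b₀ θ.b₁ Mstar, FBondY x.toKIdx → IBondY x.toKIdx}
    (h348F : ∀ x : MemberY θ.d₆ θ.ℓ₆ θ.hd' θ.hL' θ.b₀ θ.b₁ Mstar, M39 ≤ (geo9Y x).M → ∀ α₀ : ℝ, 0 < α₀ → c * (geo9Y x).M * α₀ ≤ a39 →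
      ∀ U : (bg9YR (Matrix (Fin N) (Fin N) ℂ) (specialUnitaryUnits (Fin N)) R₁ R₂ x).Cfg,
        (bg9YR (Matrix (Fin N) (Fin N) ℂ) (specialUnitaryUnits (Fin N)) R₁ R₂ x).Reg335 c α₀ U →
          Conv348Blk (oneCubeOps39YF θ Mstar 𝔏 bI x) B39 δ39 U) :
    ∀ x : MemberY θ.d₆ θ.ℓ₆ θ.hd' θ.hL' θ.b₀ θ.b₁ Mstar, M39 ≤ (geo9Y x).M → ∀ α₀ : ℝ, 0 < α₀ → c * (geo9Y x).M * α₀ ≤ a39 →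
      ∀ U : (bg9YR (Matrix (Fin N) (Fin N) ℂ) (specialUnitaryUnits (Fin N)) R₁ R₂ x).Cfg,
        (bg9YR (Matrix (Fin N) (Fin N) ℂ) (specialUnitaryUnits (Fin N)) R₁ R₂ x).Reg335 c α₀ U →
          Conv348Blk (oneCubeOps39 (geo9Y x) (bg9YR (Matrix (Fin N) (Fin N) ℂ) (specialUnitaryUnits (Fin N)) R₁ R₂ x)
            (blk39F (Matrix (Fin N) (Fin N) ℂ) x.toKIdx (bI x)) (L39 x.toKIdx (parKnitY x.toKIdx) (𝔏 x).Gp)) B39 δ39 U :=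
  fun x hM α₀ hα ha U hU => (conv348Blk_oneCubeYF_iff_knitPin θ Mstar 𝔏 (hP x) R₁ R₂ bI B39 δ39 U).1 (h348F x hM α₀ hα ha U hU)

/-! ## §2 Rows 15–16's theorem at the bond map of record `bIYOfRecord` (the certificate's pin `hbI`), section-carrying members -/

/-- ★ **ROWS 15–16 AT THE KNIT LETTER, AT THE BOND MAP OF RECORD**: `B9Thm32Conv348AtKnitLetterOfRegYP335.conv348_oneCube_parKnitY_of_regYR_section_letters` with
`bI := bIYOfRecord θ M⋆` and its faithfulness binder `hβI` DISCHARGED by node00-def-Y's `bIYOfRecord_hβI`: for every letters family with `(𝔏 x).Gp = GpY x (parKnitY x)`,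
the R-generic premise (`0 < c`, `hRP1`) gives `M₁, a₁, B₀, δ₀ > 0` with «KC»'s `h348` conclusion at every SECTION-CARRYING member above `M₁`.
[cite: Balaban1985BackgroundPropagators, Thm 3.2 (3.48) p.398 + (3.96) p.411 + (3.19) p.393 + (3.35) p.396; Balaban1984PropagatorsII, (2.45) p.231 + p.248] -/
theorem conv348_oneCube_parKnitY_bIYOfRecord_of_regYR_section (hN : 1 ≤ N)
    (hGp : ∀ x : MemberY θ.d₆ θ.ℓ₆ θ.hd' θ.hL' θ.b₀ θ.b₁ Mstar, (𝔏 x).Gp = GpY x.toKIdx (parKnitY x.toKIdx))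
    {R₁ R₂ : RegFamY θ.d₆ θ.ℓ₆ θ.hd' θ.hL' θ.b₀ θ.b₁ Mstar (Matrix (Fin N) (Fin N) ℂ)} {c : ℝ} (hc : 0 < c)
    (hRP1 : ∀ (x : MemberY θ.d₆ θ.ℓ₆ θ.hd' θ.hL' θ.b₀ θ.b₁ Mstar) (α₀ : ℝ)
      (U : (bg9YR (Matrix (Fin N) (Fin N) ℂ) (specialUnitaryUnits (Fin N)) R₁ R₂ x).Cfg),
      (bg9YR (Matrix (Fin N) (Fin N) ℂ) (specialUnitaryUnits (Fin N)) R₁ R₂ x).Reg335 c α₀ U →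
        0 ≤ α₀ ∧ (bg9YP (Matrix (Fin N) (Fin N) ℂ) (specialUnitaryUnits (Fin N)) x).Reg335 c35Y α₀ U) :
    ∃ M₁ a₁ B₀ δ₀ : ℝ, 0 < M₁ ∧ 0 < a₁ ∧ 0 < B₀ ∧ 0 < δ₀ ∧
    ∀ (x : MemberY θ.d₆ θ.ℓ₆ θ.hd' θ.hL' θ.b₀ θ.b₁ Mstar), Function.Surjective (β x.hN x.D x.hk) → M₁ ≤ (geo9Y x).M →
      ∀ α₀ : ℝ, 0 < α₀ → c * (geo9Y x).M * α₀ ≤ a₁ →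
      ∀ U : (bg9YR (Matrix (Fin N) (Fin N) ℂ) (specialUnitaryUnits (Fin N)) R₁ R₂ x).Cfg,
        (bg9YR (Matrix (Fin N) (Fin N) ℂ) (specialUnitaryUnits (Fin N)) R₁ R₂ x).Reg335 c α₀ U →
        Conv348Blk (oneCubeOps39 (geo9Y x) (bg9YR (Matrix (Fin N) (Fin N) ℂ) (specialUnitaryUnits (Fin N)) R₁ R₂ x)
          (blk39F (Matrix (Fin N) (Fin N) ℂ) x.toKIdx (bIYOfRecord θ Mstar x)) (L39 x.toKIdx (parKnitY x.toKIdx) (𝔏 x).Gp)) B₀ δ₀ U := by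
  obtain ⟨M₁, a₁, B₀, δ₀, hM₁, ha₁, hB₀, hδ₀, h⟩ := conv348_oneCube_parKnitY_of_regYR_section_letters (N := N) θ Mstar hN 𝔏 hGp hc hRP1
  exact ⟨M₁, a₁, B₀, δ₀, hM₁, ha₁, hB₀, hδ₀, fun x hsurj hM α₀ hα ha U hU =>
    h (bIYOfRecord θ Mstar) (bIYOfRecord_hβI θ Mstar) x hsurj hM α₀ hα ha U hU⟩

end Literature.MathematicalPhysics.QuantumFieldTheory.Balaban1983to89.B9KnitRow1516DisplayBridgeY

end
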